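import Summits.AtomisticToContinuum.Crystallization.Theorems.FrustratedLawDichotomyStrainedPatchHomValueT2TrackKernel
import Summits.AtomisticToContinuum.Crystallization.Theorems.FrustratedLawDichotomyStrainedPatchHomValueT2SoundS

/-!
# (I1) bookkeeping for the K-edition kernel report (`…HomValueT2TrackKernel` §20): the BALANCED FOLD is the plain fold
# (27623 `(H) HomFloor`, hcp half; critic row 1674 (B) (I1) docket item 4 `treeFold_eq_foldl`; decomp-a2c hand-1 g49)

`treeFold f z fuel l = l.foldl f z` for every `fuel`, relative to an `f`-closed predicate `S` on which `f` is associative and `z` is a left unit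
(for `AccP.add` / `ClassPiece.add` take `S` = «arrays of the nominal sizes»: the `ofFn`-rebuilt sums are associative entrywise and `zero` is a left
unit on such accumulators — `treeFold_AccP`, `treeFold_ClassPiece`).  No definitions; 0 sorry; standard axioms.  `--supports stmt-AtomisticToContinuum-27623`.
-/

namespace Summit.AtomisticToContinuum.Crystallization.Theorems.FrustratedLawDichotomyStrainedPatchHomValueT2Kit

variable {α : Type}

/-- `pairUp` preserves an `f`-closed predicate. [formal bookkeeping] -/
theorem pairUp_forall (f : α → α → α) (S : α → Prop) (hS : ∀ a b, S a → S b → S (f a b)) :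
    ∀ l : List α, (∀ a ∈ l, S a) → ∀ a ∈ pairUp f l, S a
  | [], _ => by simp [pairUp]
  | [a], h => by simpa [pairUp] using h
  | a :: b :: rest, h => by
      intro x hx
      simp only [pairUp, List.mem_cons] at hx
      rcases hx with rfl | hx
      · exact hS a b (h a (by simp)) (h b (by simp))
      · exact pairUp_forall f S hS rest (fun y hy => h y (by simp [hy])) x hx

/-- Folding the paired list equals folding the list, by associativity inside `S`. [formal bookkeeping] -/
theorem foldl_pairUp (f : α → α → α) (S : α → Prop) (hS : ∀ a b, S a → S b → S (f a b))
    (hassoc : ∀ a b c, S a → S b → S c → f (f a b) c = f a (f b c)) :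
    ∀ (l : List α) (w : α), S w → (∀ a ∈ l, S a) → (pairUp f l).foldl f w = l.foldl f w
  | [], w, _, _ => by simp [pairUp]
  | [a], w, _, _ => by simp [pairUp]
  | a :: b :: rest, w, hw, h => by
      have ha := h a (by simp)
      have hb := h b (by simp)
      simp only [pairUp, List.foldl_cons]
      rw [← hassoc w a b hw ha hb]
      exact foldl_pairUp f S hS hassoc rest _ (hS _ _ (hS _ _ hw ha) hb) (fun y hy => h y (by simp [hy]))

/-- ★ **The balanced fold is the plain fold** (`…TrackKernel` §20), for ANY fuel: relative to an `f`-closed predicate `S` containing `z` and the list, on which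
`f` is associative and `z` a left unit. [formal bookkeeping] -/
theorem treeFold_eq_foldl (f : α → α → α) (z : α) (S : α → Prop) (hS : ∀ a b, S a → S b → S (f a b))
    (hassoc : ∀ a b c, S a → S b → S c → f (f a b) c = f a (f b c)) (hz : ∀ a, S a → f z a = a) (hzS : S z) :
    ∀ (fuel : ℕ) (l : List α), (∀ a ∈ l, S a) → treeFold f z fuel l = l.foldl f z
  | 0, l, _ => rfl
  | _ + 1, [], _ => rfl
  | _ + 1, [a], h => by simp [treeFold, hz a (h a (by simp))]
  | fuel + 1, a :: b :: rest, h => by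
      rw [treeFold, treeFold_eq_foldl f z S hS hassoc hz hzS fuel _ (pairUp_forall f S hS _ h),
        foldl_pairUp f S hS hassoc _ z hzS h]

/-- The unrelativised form: `f` associative with left unit `z` ⟹ `treeFold f z fuel l = l.foldl f z`. [formal bookkeeping] -/
theorem treeFold_eq_foldl' (f : α → α → α) (z : α) (hassoc : ∀ a b c, f (f a b) c = f a (f b c)) (hz : ∀ a, f z a = a)
    (fuel : ℕ) (l : List α) : treeFold f z fuel l = l.foldl f z :=
  treeFold_eq_foldl f z (fun _ => True) (fun _ _ _ _ => trivial) (fun a b c _ _ _ => hassoc a b c) (fun a _ => hz a) trivial fuel l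
    (fun _ _ => trivial)

/-! ## The two accumulators of `…TrackKernel` §21: `AccP.add` / `ClassPiece.add` are associative, `zero` is a left unit on nominal sizes -/

open Literature.Analysis.ValidatedNumerics.Numerics

/-- `fi0 + I = I`. [arithmetic] -/
theorem fi0_add (I : FI) : fi0.add I = I := by
  cases I; simp [FI.add, fi0, FI.ofInt]

/-- `addArr n` is associative. [formal bookkeeping] -/
theorem addArr_assoc (n : ℕ) (A B C : Array FI) : addArr n (addArr n A B) C = addArr n A (addArr n B C) := by
  have h : ∀ i : Fin n, ((addArr n A B).getD i.val fi0).add (C.getD i.val fi0) = (A.getD i.val fi0).add ((addArr n B C).getD i.val fi0) :=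
    fun i => by rw [addArr_getD i.isLt, addArr_getD i.isLt]; simp only [FI.add, add_assoc]
  rw [show addArr n (addArr n A B) C = Array.ofFn (fun i : Fin n => ((addArr n A B).getD i.val fi0).add (C.getD i.val fi0)) from rfl,
    show addArr n A (addArr n B C) = Array.ofFn (fun i : Fin n => (A.getD i.val fi0).add ((addArr n B C).getD i.val fi0)) from rfl]
  exact congrArg Array.ofFn (funext h)

/-- `zeroArr n + A = A` for an array of size `n`. [formal bookkeeping] -/
theorem zeroArr_addArr {n : ℕ} {A : Array FI} (hA : A.size = n) : addArr n (zeroArr n) A = A := by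
  subst hA
  refine Array.ext (by simp [addArr]) fun i h1 h2 => ?_
  have e := addArr_getD h2 (zeroArr A.size) A
  rw [zeroArr_getD, fi0_add, Array.getD_eq_getD_getElem?, Array.getD_eq_getD_getElem?, Array.getElem?_eq_getElem h1,
    Array.getElem?_eq_getElem h2, Option.getD_some, Option.getD_some] at e
  exact e

/-- `addArrZ n` is associative. [formal bookkeeping] -/
theorem addArrZ_assoc (n : ℕ) (A B C : Array ℤ) : addArrZ n (addArrZ n A B) C = addArrZ n A (addArrZ n B C) := by
  have hget : ∀ (X Y : Array ℤ) (i : Fin n), (addArrZ n X Y).getD i.val 0 = X.getD i.val 0 + Y.getD i.val 0 := fun X Y i => by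
    unfold addArrZ; rw [getD_ofFn_lt _ _ i.isLt]
  have h : ∀ i : Fin n, (addArrZ n A B).getD i.val 0 + C.getD i.val 0 = A.getD i.val 0 + (addArrZ n B C).getD i.val 0 :=
    fun i => by rw [hget, hget, add_assoc]
  rw [show addArrZ n (addArrZ n A B) C = Array.ofFn (fun i : Fin n => (addArrZ n A B).getD i.val 0 + C.getD i.val 0) from rfl,
    show addArrZ n A (addArrZ n B C) = Array.ofFn (fun i : Fin n => A.getD i.val 0 + (addArrZ n B C).getD i.val 0) from rfl]
  exact congrArg Array.ofFn (funext h)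

/-- `replicate n 0 + A = A` for an integer array of size `n`. [formal bookkeeping] -/
theorem replicate_addArrZ {n : ℕ} {A : Array ℤ} (hA : A.size = n) : addArrZ n (Array.replicate n 0) A = A := by
  subst hA
  refine Array.ext (by simp [addArrZ]) fun i h1 h2 => ?_
  have e : (addArrZ A.size (Array.replicate A.size 0) A).getD i 0 = (Array.replicate A.size (0 : ℤ)).getD i 0 + A.getD i 0 := by
    unfold addArrZ; rw [getD_ofFn_lt _ _ h2]
  rw [Array.getD_eq_getD_getElem?, Array.getD_eq_getD_getElem?, Array.getD_eq_getD_getElem?, Array.getElem?_eq_getElem h1,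
    Array.getElem?_eq_getElem h2, Array.getElem?_replicate, if_pos h2, Option.getD_some, Option.getD_some, Option.getD_some, zero_add] at e
  exact e

/-- `AccP.add` is associative. [formal bookkeeping] -/
theorem AccP.add_assoc (P Q R : AccP) : (P.add Q).add R = P.add (Q.add R) := by
  simp only [AccP.add, addArr_assoc, Bool.and_assoc]

/-- `AccP.zero` is a left unit on accumulators of the nominal sizes `81, 9, 3, 18`. [formal bookkeeping] -/
theorem AccP.zero_add (P : AccP) (h : P.H.size = 81 ∧ P.g.size = 9 ∧ P.fc.size = 3 ∧ P.jc.size = 18) : AccP.zero.add P = P := by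
  obtain ⟨h1, h2, h3, h4⟩ := h
  cases P
  simp only [AccP.add, AccP.zero, Bool.true_and, zeroArr_addArr h1, zeroArr_addArr h2, zeroArr_addArr h3, zeroArr_addArr h4]

/-- ★ The balanced point pass equals the plain fold (pieces of the nominal sizes). [formal bookkeeping] -/
theorem treeFold_AccP (fuel : ℕ) (l : List AccP) (hl : ∀ P ∈ l, P.H.size = 81 ∧ P.g.size = 9 ∧ P.fc.size = 3 ∧ P.jc.size = 18) :
    treeFold AccP.add AccP.zero fuel l = l.foldl AccP.add AccP.zero :=
  treeFold_eq_foldl AccP.add AccP.zero (fun P => P.H.size = 81 ∧ P.g.size = 9 ∧ P.fc.size = 3 ∧ P.jc.size = 18)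
    (fun P Q _ _ => by simp [AccP.add, addArr]) (fun P Q R _ _ _ => AccP.add_assoc P Q R) (fun P hP => AccP.zero_add P hP)
    (by simp [AccP.zero, zeroArr]) fuel l hl

/-- `ClassPiece.add` is associative. [formal bookkeeping] -/
theorem ClassPiece.add_assoc (P Q R : ClassPiece) : (P.add Q).add R = P.add (Q.add R) := by
  simp only [ClassPiece.add, addArrZ_assoc, Bool.and_assoc]

/-- `ClassPiece.zero` is a left unit on pieces of the nominal sizes `729, 81, 243, 18`. [formal bookkeeping] -/
theorem ClassPiece.zero_add (P : ClassPiece) (h : P.lam.size = 729 ∧ P.r0.size = 81 ∧ P.s2.size = 243 ∧ P.jh.size = 18) :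
    ClassPiece.zero.add P = P := by
  obtain ⟨h1, h2, h3, h4⟩ := h
  cases P
  simp only [ClassPiece.add, ClassPiece.zero, Bool.true_and, replicate_addArrZ h1, replicate_addArrZ h2, replicate_addArrZ h3,
    replicate_addArrZ h4]

/-- ★ The balanced class pass equals the plain fold (pieces of the nominal sizes). [formal bookkeeping] -/
theorem treeFold_ClassPiece (fuel : ℕ) (l : List ClassPiece) (hl : ∀ P ∈ l, P.lam.size = 729 ∧ P.r0.size = 81 ∧ P.s2.size = 243 ∧ P.jh.size = 18) :
    treeFold ClassPiece.add ClassPiece.zero fuel l = l.foldl ClassPiece.add ClassPiece.zero :=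
  treeFold_eq_foldl ClassPiece.add ClassPiece.zero (fun P => P.lam.size = 729 ∧ P.r0.size = 81 ∧ P.s2.size = 243 ∧ P.jh.size = 18)
    (fun P Q _ _ => by simp [ClassPiece.add, addArrZ]) (fun P Q R _ _ _ => ClassPiece.add_assoc P Q R) (fun P hP => ClassPiece.zero_add P hP)
    (by simp [ClassPiece.zero]) fuel l hl

end Summit.AtomisticToContinuum.Crystallization.Theorems.FrustratedLawDichotomyStrainedPatchHomValueT2Kit
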